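import Summits.CriticalPhenomena.Ising3D.TaylorTableOddHeadDeltaMerged
import Summits.CriticalPhenomena.Ising3D.TaylorTableOddHeadsCert
import Mathlib.Tactic.Linarith
import HarnessLib

/-!
# The TABLE layer of a derivative certificate, XXX: odd head cells with a GENERIC final test, the MERGED instance, and its capstone
(cell `pub-ising3x`, seat boot-1 gen 9; gate (g2) — the odd FAST head layer with the merged sign test end to end)

HONEST FRAMING: lottery ticket; floor = tightest certified 3D Ising CFT bounds; no exact-solution
claim without a proof. Island framing: certified exclusion region at stated derivative order and
assumptions; not a determination of the 3D Ising critical exponents beyond that.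

**`oddHead_nonneg_of_partsΔ_sound`** = the cell theorem of file XXVII with the final Boolean split into its structural half
`oddHeadStructOK` and a soundness HYPOTHESIS on the summed claims (the conclusion shape of `posOnOdd_sound`; proof verbatim);
**`oddHead_nonneg_of_partsΔM`** = the instance with the MERGED test `oddHeadFinalOKΔM` (file XXIX); `TaylorTable.oddFinalOKM`,
**`oddHeads_of_certΔM`**, **`boxExcluded_of_taylorTable_certΔM`** = the certificate-level wrappers of file XXVIII with the merged
final check (same `OddHeadCertΔ` data). Why: HOME/pub-ising3x-boot-1/HEAD-DELTA.md §7. No new mathematics. [folklore]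
-/

namespace Summit.CriticalPhenomena.Ising3D

open Finset Set
open Literature.Analysis.ValidatedNumerics Literature.Analysis.ValidatedNumerics.PolyMP
open Literature.Analysis.ValidatedNumerics.NumericsMP (MI)
open Literature.MathematicalPhysics.QuantumFieldTheory.ConformalBootstrap3D
open Literature.MathematicalPhysics.QuantumFieldTheory.ConformalBootstrap3D.HRTM (rowEntry pivOK)

/-- **Odd head cell over a wide box, generic in the final sign test** (verbatim the proof of `oddHead_nonneg_of_partsΔ` with the
bisected affine test replaced by a soundness HYPOTHESIS `hsound` on the summed claims: any Boolean whose soundness has the shape of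
`posOnOdd_sound` — e.g. `posOnOddM_sound` — instantiates it). [cite: KosPolandSimmonsduffin2014, §3.3 eq. (3.16)] -/
theorem oddHead_nonneg_of_partsΔ_sound (c : Fin 5 → ℕ × ℕ → ℚ) {L : List (ℕ × ℕ)} (ψ : ℕ × ℕ → ℚ) {Lψ : List (ℕ × ℕ)}
    {κ₀ : ℚ} {C : EvenCellTM} (hF : C.F.Nodup) (hFj : ∀ q ∈ C.F, q.2 ≤ C.ℓ + q.1) (hℓlo : (C.ℓ : ℚ) ≤ C.lo)
    {σlo σhi εlo εhi : ℚ} {R : OddHeadRowsΔ} (hR : R.ValidΔ c L ψ Lψ σlo σhi εlo εhi) {t₁ t₂ : ℚ}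
    (ht₁ : t₁ ≤ σlo - εhi) (ht₂ : σhi - εlo ≤ t₂) {K Mσ Mε : MI}
    (hK : ∀ p ∈ Icc (σlo : ℝ) σhi ×ˢ Icc (εlo : ℝ) εhi, MI.mem R.S ((1 / 2 : ℝ) ^ (p.2 - p.1)) K)
    (hMσ : ∀ p ∈ Icc (σlo : ℝ) σhi ×ˢ Icc (εlo : ℝ) εhi, MI.mem R.S ((1 / 2 : ℝ) ^ (-(2 * p.1))) Mσ)
    (hMε : ∀ p ∈ Icc (σlo : ℝ) σhi ×ˢ Icc (εlo : ℝ) εhi, MI.mem R.S ((1 / 2 : ℝ) ^ (-(2 * p.2))) Mε)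
    {ps : List HeadPartOdd} (hparts : ∀ p ∈ ps, oddHeadPartOKΔ R C t₁ t₂ p = true)
    (h : oddHeadStructOK R C t₁ t₂ κ₀ ps = true)
    (hsound : ∀ {r3 r4 r5 rt : List ℝ × List ℝ × List ℝ} {r0 : List ℝ},
      PMem3 R.S r3 (sumV HeadPartOdd.v3 ps) → PMem3 R.S r4 (sumV HeadPartOdd.v4 ps) → PMem3 R.S r5 (sumV HeadPartOdd.v5 ps) →
      PMem R.S r0 (sumPX (ps.map HeadPartOdd.v0)) → PMem3 R.S rt (sumV HeadPartOdd.vt ps) →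
      ∀ {c3 c0 ct : ℝ}, MI.mem R.S c3 (smulRatMI K ((-1) ^ C.ℓ)) → MI.mem R.S c0 (smulRatMI Mσ (κ₀⁻¹ / 2)) →
      MI.mem R.S ct (smulRatMI Mε (-(κ₀⁻¹ / 2))) →
      ∀ {δb δσ δt : ℝ}, |δb| ≤ R.Wb → |δσ| ≤ R.Wσ → |δt| ≤ R.Wt →
      ∀ {x : ℝ}, ((-C.hw : ℚ) : ℝ) ≤ x → x ≤ ((C.hw : ℚ) : ℝ) →
        0 < val3 r4 x δσ - val3 r5 x δσ + c3 * val3 r3 x δb + c0 * evalR r0 x + ct * val3 rt x δt) :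
    ∀ p ∈ Icc (σlo : ℝ) σhi ×ˢ Icc (εlo : ℝ) εhi, ∀ Δ : ℝ, (C.lo : ℝ) ≤ Δ → Δ ≤ C.hi → unitarityBound3D C.ℓ < Δ →
      0 ≤ ∑ q ∈ C.F.toFinset, oddConeHeadValue
        (taylorCrossing (1 / 2) (1 / 2) L.toFinset (fun k ab => (c k ab : ℝ)))
        (∑ ab ∈ Lψ.toFinset, (ψ ab : ℝ) • taylorCoeffAt (1 / 2) (1 / 2) ab) κ₀ p.1 p.2 Δ C.ℓ q := by
  intro p hp Δ hlo hhi hbΔ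
  obtain ⟨hS, hWσ, hWε, hV⟩ := hR
  obtain ⟨hδσ, hδε, hrows⟩ := hV p hp
  have hp' := hp
  simp only [Set.mem_prod, Set.mem_Icc] at hp'
  obtain ⟨⟨h1, h2⟩, ⟨h3, h4⟩⟩ := hp'
  have hWb : 0 ≤ R.Wb := by unfold OddHeadRowsΔ.Wb; linarith
  have hWt : 0 ≤ R.Wt := by unfold OddHeadRowsΔ.Wt; linarith
  have hδb : |(p.1 + p.2) / 2 - R.b0| ≤ R.Wb := by
    unfold OddHeadRowsΔ.b0 OddHeadRowsΔ.Wb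
    rw [abs_le] at hδσ hδε ⊢; push_cast; constructor <;> linarith [hδσ.1, hδσ.2, hδε.1, hδε.2]
  have hδt : |(p.1 - p.2) - R.t0| ≤ R.Wt := by
    unfold OddHeadRowsΔ.t0 OddHeadRowsΔ.Wt
    rw [abs_le] at hδσ hδε ⊢; push_cast; constructor <;> linarith [hδσ.1, hδσ.2, hδε.1, hδε.2]
  simp only [oddHeadStructOK, Bool.and_eq_true, decide_eq_true_eq, List.all_eq_true] at h
  obtain ⟨⟨⟨⟨⟨hD, hpiv⟩, _⟩, _⟩, hJ⟩, htile⟩ := h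
  -- the local variable
  set ρ : ℝ := Δ - (C.ctr : ℝ) with hρdef
  have hΔ : Δ = (C.ctr : ℝ) + ρ := by rw [hρdef]; ring
  have hlo' : ((C.lo : ℚ) : ℝ) = (C.ctr : ℝ) - ((C.hw : ℚ) : ℝ) := by rw [EvenCellTM.lo]; push_cast; ring
  have hhi' : ((C.hi : ℚ) : ℝ) = (C.ctr : ℝ) + ((C.hw : ℚ) : ℝ) := by rw [EvenCellTM.hi]; push_cast; ring
  have hρ1 : ((-C.hw : ℚ) : ℝ) ≤ ρ := by push_cast; linarith
  have hρ2 : ρ ≤ ((C.hw : ℚ) : ℝ) := by linarith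
  have hρabs : |ρ| ≤ ((1 : ℚ) / 2 ^ C.e : ℚ) := by
    have : ((C.hw : ℚ) : ℝ) = (((1 : ℚ) / 2 ^ C.e : ℚ) : ℝ) := by rw [EvenCellTM.hw]
    rw [abs_le, ← this]; exact ⟨by linarith, hρ2⟩
  have hℓΔ : (C.ℓ : ℝ) ≤ Δ := by
    have : ((C.ℓ : ℚ) : ℝ) ≤ ((C.lo : ℚ) : ℝ) := by exact_mod_cast hℓlo
    push_cast at this
    linarith
  -- the three (a, b) boxes
  set t : ℝ := p.1 - p.2 with htdef
  have ht1 : (t₁ : ℝ) ≤ t := by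
    have : ((t₁ : ℚ) : ℝ) ≤ ((σlo - εhi : ℚ) : ℝ) := by exact_mod_cast ht₁
    push_cast at this; linarith
  have ht2 : t ≤ (t₂ : ℝ) := by
    have : ((σhi - εlo : ℚ) : ℝ) ≤ ((t₂ : ℚ) : ℝ) := by exact_mod_cast ht₂
    push_cast at this; linarith
  have habS : HRTMAB.InBox (-t₂ / 2) (-t₁ / 2) (t₁ / 2) (t₂ / 2) (-t / 2) (t / 2) :=
    ⟨⟨by push_cast; linarith, by push_cast; linarith⟩, ⟨by push_cast; linarith, by push_cast; linarith⟩⟩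
  have habP : HRTMAB.InBox (t₁ / 2) (t₂ / 2) (t₁ / 2) (t₂ / 2) (t / 2) (t / 2) :=
    ⟨⟨by push_cast; linarith, by push_cast; linarith⟩, ⟨by push_cast; linarith, by push_cast; linarith⟩⟩
  have habM : HRTMAB.InBox (-t₂ / 2) (-t₁ / 2) (-t₂ / 2) (-t₁ / 2) (-t / 2) (-t / 2) :=
    ⟨⟨by push_cast; linarith, by push_cast; linarith⟩, ⟨by push_cast; linarith, by push_cast; linarith⟩⟩
  -- Taylor models of the three regularised coefficient families at this ρ
  have htmS : ∀ q ∈ C.F, ∃ as : List ℝ, PMem R.S as (rowEntry (C.tmsS R.S t₁ t₂) C.nF q.1 q.2) ∧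
      regAB (-t / 2) (t / 2) ((C.ctr : ℝ) + ρ) C.ℓ q.1 q.2 = evalR as ρ :=
    fun q hq => HRTMAB.tmem_rows hS hD hpiv habS (C.le_nF q hq) q.2 ρ hρabs
  have htmP : ∀ q ∈ C.F, ∃ as : List ℝ, PMem R.S as (rowEntry (C.tmsP R.S t₁ t₂) C.nF q.1 q.2) ∧
      regAB (t / 2) (t / 2) ((C.ctr : ℝ) + ρ) C.ℓ q.1 q.2 = evalR as ρ :=
    fun q hq => HRTMAB.tmem_rows hS hD hpiv habP (C.le_nF q hq) q.2 ρ hρabs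
  have htmM : ∀ q ∈ C.F, ∃ as : List ℝ, PMem R.S as (rowEntry (C.tmsM R.S t₁ t₂) C.nF q.1 q.2) ∧
      regAB (-t / 2) (-t / 2) ((C.ctr : ℝ) + ρ) C.ℓ q.1 q.2 = evalR as ρ :=
    fun q hq => HRTMAB.tmem_rows hS hD hpiv habM (C.le_nF q hq) q.2 ρ hρabs
  classical
  let asqS : ℕ × ℕ → List ℝ := fun q => if hq : q ∈ C.F then Classical.choose (htmS q hq) else []
  let asqP : ℕ × ℕ → List ℝ := fun q => if hq : q ∈ C.F then Classical.choose (htmP q hq) else []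
  let asqM : ℕ × ℕ → List ℝ := fun q => if hq : q ∈ C.F then Classical.choose (htmM q hq) else []
  have mS : ∀ q ∈ C.F, PMem R.S (asqS q) (rowEntry (C.tmsS R.S t₁ t₂) C.nF q.1 q.2) := by
    intro q hq; simp only [asqS, dif_pos hq]; exact (Classical.choose_spec (htmS q hq)).1
  have vS : ∀ q ∈ C.F, regAB (-t / 2) (t / 2) ((C.ctr : ℝ) + ρ) C.ℓ q.1 q.2 = evalR (asqS q) ρ := by
    intro q hq; simp only [asqS, dif_pos hq]; exact (Classical.choose_spec (htmS q hq)).2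
  have mP : ∀ q ∈ C.F, PMem R.S (asqP q) (rowEntry (C.tmsP R.S t₁ t₂) C.nF q.1 q.2) := by
    intro q hq; simp only [asqP, dif_pos hq]; exact (Classical.choose_spec (htmP q hq)).1
  have vP : ∀ q ∈ C.F, regAB (t / 2) (t / 2) ((C.ctr : ℝ) + ρ) C.ℓ q.1 q.2 = evalR (asqP q) ρ := by
    intro q hq; simp only [asqP, dif_pos hq]; exact (Classical.choose_spec (htmP q hq)).2
  have mM : ∀ q ∈ C.F, PMem R.S (asqM q) (rowEntry (C.tmsM R.S t₁ t₂) C.nF q.1 q.2) := by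
    intro q hq; simp only [asqM, dif_pos hq]; exact (Classical.choose_spec (htmM q hq)).1
  have vM : ∀ q ∈ C.F, regAB (-t / 2) (-t / 2) ((C.ctr : ℝ) + ρ) C.ℓ q.1 q.2 = evalR (asqM q) ρ := by
    intro q hq; simp only [asqM, dif_pos hq]; exact (Classical.choose_spec (htmM q hq)).2
  -- the five row families (choose per j)
  let r3 : ℕ → List ℝ × List ℝ × List ℝ := fun j => if hj : j < R.J then Classical.choose (hrows j hj).1 else ([], [], [])
  let r4 : ℕ → List ℝ × List ℝ × List ℝ := fun j => if hj : j < R.J then Classical.choose (hrows j hj).2.1 else ([], [], [])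
  let r5 : ℕ → List ℝ × List ℝ × List ℝ := fun j =>
    if hj : j < R.J then Classical.choose (hrows j hj).2.2.1 else ([], [], [])
  let r0 : ℕ → List ℝ × List ℝ × List ℝ := fun j =>
    if hj : j < R.J then Classical.choose (hrows j hj).2.2.2.1 else ([], [], [])
  let rt : ℕ → List ℝ × List ℝ × List ℝ := fun j =>
    if hj : j < R.J then Classical.choose (hrows j hj).2.2.2.2 else ([], [], [])
  have s3 : ∀ q ∈ C.F, PMem3 R.S (r3 q.2) (R.lit q.2).1 ∧ ∀ E : ℝ,
      qSum (fun ab => (c 2 ab : ℝ)) L.toFinset ((p.1 + p.2) / 2) (-1) E q.2 = val3 (r3 q.2) E ((p.1 + p.2) / 2 - R.b0) := by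
    intro q hq; have hs := Classical.choose_spec (hrows q.2 (hJ q hq)).1; simp only [r3, dif_pos (hJ q hq)]; exact hs
  have s4 : ∀ q ∈ C.F, PMem3 R.S (r4 q.2) (R.lit q.2).2.1 ∧ ∀ E : ℝ,
      qSum (fun ab => (c 3 ab : ℝ)) L.toFinset p.1 (-1) E q.2 = val3 (r4 q.2) E (p.1 - R.σ0) := by
    intro q hq; have hs := Classical.choose_spec (hrows q.2 (hJ q hq)).2.1; simp only [r4, dif_pos (hJ q hq)]; exact hs
  have s5 : ∀ q ∈ C.F, PMem3 R.S (r5 q.2) (R.lit q.2).2.2.1 ∧ ∀ E : ℝ,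
      qSum (fun ab => (c 4 ab : ℝ)) L.toFinset p.1 1 E q.2 = val3 (r5 q.2) E (p.1 - R.σ0) := by
    intro q hq; have hs := Classical.choose_spec (hrows q.2 (hJ q hq)).2.2.1; simp only [r5, dif_pos (hJ q hq)]; exact hs
  have s0 : ∀ q ∈ C.F, PMem3 R.S (r0 q.2) (R.lit q.2).2.2.2.1 ∧ ∀ E : ℝ,
      qSum (fun ab => (ψ ab : ℝ)) Lψ.toFinset 0 0 E q.2 = val3 (r0 q.2) E 0 := by
    intro q hq; have hs := Classical.choose_spec (hrows q.2 (hJ q hq)).2.2.2.1; simp only [r0, dif_pos (hJ q hq)]; exact hs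
  have st : ∀ q ∈ C.F, PMem3 R.S (rt q.2) (R.lit q.2).2.2.2.2 ∧ ∀ E : ℝ,
      qSum (fun ab => (ψ ab : ℝ)) Lψ.toFinset (p.1 - p.2) 0 E q.2 = val3 (rt q.2) E ((p.1 - p.2) - R.t0) := by
    intro q hq; have hs := Classical.choose_spec (hrows q.2 (hJ q hq)).2.2.2.2; simp only [rt, dif_pos (hJ q hq)]; exact hs
  -- the part checks, group by group
  have hpart : ∀ p' ∈ ps, oddHeadPartOKΔ R C t₁ t₂ p' = true := hparts
  have hg3 : ∀ p' ∈ ps.map HeadPartOdd.v3,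
      (subsetI (headPolyTM R.S (R.rows 0 0) (C.tmsS R.S t₁ t₂) C.nF C.ℓ C.ctr (p'.slice C.F)) p'.PX &&
      subsetI (headPolyTM R.S (R.rows 0 1) (C.tmsS R.S t₁ t₂) C.nF C.ℓ C.ctr (p'.slice C.F)) p'.PY &&
      subsetI (headPolyTM R.S (R.rows 0 2) (C.tmsS R.S t₁ t₂) C.nF C.ℓ C.ctr (p'.slice C.F)) p'.PZ) = true := by
    intro p' hp'
    obtain ⟨p3, hp3, rfl⟩ := List.mem_map.mp hp'
    have h := hpart p3 hp3
    simp only [oddHeadPartOKΔ, famTriple, subset3, Bool.and_eq_true] at h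
    simp only [HeadPartOdd.v3, HeadPart.slice, Bool.and_eq_true]
    exact h.1.1.1.1
  have hg4 : ∀ p' ∈ ps.map HeadPartOdd.v4,
      (subsetI (headPolyTM R.S (R.rows 1 0) (C.tmsP R.S t₁ t₂) C.nF C.ℓ C.ctr (p'.slice C.F)) p'.PX &&
      subsetI (headPolyTM R.S (R.rows 1 1) (C.tmsP R.S t₁ t₂) C.nF C.ℓ C.ctr (p'.slice C.F)) p'.PY &&
      subsetI (headPolyTM R.S (R.rows 1 2) (C.tmsP R.S t₁ t₂) C.nF C.ℓ C.ctr (p'.slice C.F)) p'.PZ) = true := by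
    intro p' hp'
    obtain ⟨p3, hp3, rfl⟩ := List.mem_map.mp hp'
    have h := hpart p3 hp3
    simp only [oddHeadPartOKΔ, famTriple, subset3, Bool.and_eq_true] at h
    simp only [HeadPartOdd.v4, HeadPart.slice, Bool.and_eq_true]
    exact h.1.1.1.2
  have hg5 : ∀ p' ∈ ps.map HeadPartOdd.v5,
      (subsetI (headPolyTM R.S (R.rows 2 0) (C.tmsP R.S t₁ t₂) C.nF C.ℓ C.ctr (p'.slice C.F)) p'.PX &&
      subsetI (headPolyTM R.S (R.rows 2 1) (C.tmsP R.S t₁ t₂) C.nF C.ℓ C.ctr (p'.slice C.F)) p'.PY &&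
      subsetI (headPolyTM R.S (R.rows 2 2) (C.tmsP R.S t₁ t₂) C.nF C.ℓ C.ctr (p'.slice C.F)) p'.PZ) = true := by
    intro p' hp'
    obtain ⟨p3, hp3, rfl⟩ := List.mem_map.mp hp'
    have h := hpart p3 hp3
    simp only [oddHeadPartOKΔ, famTriple, subset3, Bool.and_eq_true] at h
    simp only [HeadPartOdd.v5, HeadPart.slice, Bool.and_eq_true]
    exact h.1.1.2
  have hg0 : ∀ p' ∈ ps.map HeadPartOdd.v0,
      (subsetI (headPolyTM R.S (R.rows 3 0) (C.tmsM R.S t₁ t₂) C.nF C.ℓ C.ctr (p'.slice C.F)) p'.PX &&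
      subsetI (headPolyTM R.S (R.rows 3 0) (C.tmsM R.S t₁ t₂) C.nF C.ℓ C.ctr (p'.slice C.F)) p'.PY &&
      subsetI (headPolyTM R.S (R.rows 3 0) (C.tmsM R.S t₁ t₂) C.nF C.ℓ C.ctr (p'.slice C.F)) p'.PZ) = true := by
    intro p' hp'
    obtain ⟨p3, hp3, rfl⟩ := List.mem_map.mp hp'
    have h := hpart p3 hp3
    simp only [oddHeadPartOKΔ, famTriple, subset3, Bool.and_eq_true] at h
    simp only [HeadPartOdd.v0, HeadPart.slice, Bool.and_eq_true]
    exact ⟨⟨h.1.2, h.1.2⟩, h.1.2⟩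
  have hgt : ∀ p' ∈ ps.map HeadPartOdd.vt,
      (subsetI (headPolyTM R.S (R.rows 4 0) (C.tmsP R.S t₁ t₂) C.nF C.ℓ C.ctr (p'.slice C.F)) p'.PX &&
      subsetI (headPolyTM R.S (R.rows 4 1) (C.tmsP R.S t₁ t₂) C.nF C.ℓ C.ctr (p'.slice C.F)) p'.PY &&
      subsetI (headPolyTM R.S (R.rows 4 2) (C.tmsP R.S t₁ t₂) C.nF C.ℓ C.ctr (p'.slice C.F)) p'.PZ) = true := by
    intro p' hp'
    obtain ⟨p3, hp3, rfl⟩ := List.mem_map.mp hp'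
    have h := hpart p3 hp3
    simp only [oddHeadPartOKΔ, famTriple, subset3, Bool.and_eq_true] at h
    simp only [HeadPartOdd.vt, HeadPart.slice, Bool.and_eq_true]
    exact h.2
  have ht4 : tilesOK 0 (ps.map HeadPartOdd.v4) C.F.length = true := by rw [tilesOK_v4]; exact htile
  have ht5 : tilesOK 0 (ps.map HeadPartOdd.v5) C.F.length = true := by rw [tilesOK_v5]; exact htile
  have ht0 : tilesOK 0 (ps.map HeadPartOdd.v0) C.F.length = true := by rw [tilesOK_v0]; exact htile
  have htt : tilesOK 0 (ps.map HeadPartOdd.vt) C.F.length = true := by rw [tilesOK_vt]; exact htile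
  -- row memberships in the projected row lists
  have m30 : ∀ q ∈ C.F, PMem R.S (r3 q.2).1 ((R.rows 0 0).getD q.2 []) := fun q hq => by
    rw [R.getD_rows₀]; exact (s3 q hq).1.fst
  have m31 : ∀ q ∈ C.F, PMem R.S (r3 q.2).2.1 ((R.rows 0 1).getD q.2 []) := fun q hq => by
    rw [R.getD_rows₁]; exact (s3 q hq).1.snd
  have m32 : ∀ q ∈ C.F, PMem R.S (r3 q.2).2.2 ((R.rows 0 2).getD q.2 []) := fun q hq => by
    rw [R.getD_rows₂]; exact (s3 q hq).1.thd
  have m40 : ∀ q ∈ C.F, PMem R.S (r4 q.2).1 ((R.rows 1 0).getD q.2 []) := fun q hq => by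
    rw [R.getD_rows₀]; exact (s4 q hq).1.fst
  have m41 : ∀ q ∈ C.F, PMem R.S (r4 q.2).2.1 ((R.rows 1 1).getD q.2 []) := fun q hq => by
    rw [R.getD_rows₁]; exact (s4 q hq).1.snd
  have m42 : ∀ q ∈ C.F, PMem R.S (r4 q.2).2.2 ((R.rows 1 2).getD q.2 []) := fun q hq => by
    rw [R.getD_rows₂]; exact (s4 q hq).1.thd
  have m50 : ∀ q ∈ C.F, PMem R.S (r5 q.2).1 ((R.rows 2 0).getD q.2 []) := fun q hq => by
    rw [R.getD_rows₀]; exact (s5 q hq).1.fst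
  have m51 : ∀ q ∈ C.F, PMem R.S (r5 q.2).2.1 ((R.rows 2 1).getD q.2 []) := fun q hq => by
    rw [R.getD_rows₁]; exact (s5 q hq).1.snd
  have m52 : ∀ q ∈ C.F, PMem R.S (r5 q.2).2.2 ((R.rows 2 2).getD q.2 []) := fun q hq => by
    rw [R.getD_rows₂]; exact (s5 q hq).1.thd
  have m00 : ∀ q ∈ C.F, PMem R.S (r0 q.2).1 ((R.rows 3 0).getD q.2 []) := fun q hq => by
    rw [R.getD_rows₀]; exact (s0 q hq).1.fst
  have mt0 : ∀ q ∈ C.F, PMem R.S (rt q.2).1 ((R.rows 4 0).getD q.2 []) := fun q hq => by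
    rw [R.getD_rows₀]; exact (st q hq).1.fst
  have mt1 : ∀ q ∈ C.F, PMem R.S (rt q.2).2.1 ((R.rows 4 1).getD q.2 []) := fun q hq => by
    rw [R.getD_rows₁]; exact (st q hq).1.snd
  have mt2 : ∀ q ∈ C.F, PMem R.S (rt q.2).2.2 ((R.rows 4 2).getD q.2 []) := fun q hq => by
    rw [R.getD_rows₂]; exact (st q hq).1.thd
  -- the sums (parts_pmem per group)
  obtain ⟨a30, a31, a32, pm30, pm31, pm32, e30, e31, e32⟩ :=
    parts_pmem hS (ℓ := C.ℓ) (ctr := C.ctr) (RX := R.rows 0 0) (RY := R.rows 0 1) (RZ := R.rows 0 2)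
      (rowX := fun j => (r3 j).1) (rowY := fun j => (r3 j).2.1) (rowZ := fun j => (r3 j).2.2) m30 m31 m32 mS ρ
      (ps.map HeadPartOdd.v3) 0 htile hg3
  obtain ⟨a40, a41, a42, pm40, pm41, pm42, e40, e41, e42⟩ :=
    parts_pmem hS (ℓ := C.ℓ) (ctr := C.ctr) (RX := R.rows 1 0) (RY := R.rows 1 1) (RZ := R.rows 1 2)
      (rowX := fun j => (r4 j).1) (rowY := fun j => (r4 j).2.1) (rowZ := fun j => (r4 j).2.2) m40 m41 m42 mP ρ
      (ps.map HeadPartOdd.v4) 0 ht4 hg4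
  obtain ⟨a50, a51, a52, pm50, pm51, pm52, e50, e51, e52⟩ :=
    parts_pmem hS (ℓ := C.ℓ) (ctr := C.ctr) (RX := R.rows 2 0) (RY := R.rows 2 1) (RZ := R.rows 2 2)
      (rowX := fun j => (r5 j).1) (rowY := fun j => (r5 j).2.1) (rowZ := fun j => (r5 j).2.2) m50 m51 m52 mP ρ
      (ps.map HeadPartOdd.v5) 0 ht5 hg5
  obtain ⟨a00, _, _, pm00, -, -, e00, -, -⟩ :=
    parts_pmem hS (ℓ := C.ℓ) (ctr := C.ctr) (RX := R.rows 3 0) (RY := R.rows 3 0) (RZ := R.rows 3 0)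
      (rowX := fun j => (r0 j).1) (rowY := fun j => (r0 j).1) (rowZ := fun j => (r0 j).1) m00 m00 m00 mM ρ
      (ps.map HeadPartOdd.v0) 0 ht0 hg0
  obtain ⟨at0, at1, at2, pmt0, pmt1, pmt2, et0, et1, et2⟩ :=
    parts_pmem hS (ℓ := C.ℓ) (ctr := C.ctr) (RX := R.rows 4 0) (RY := R.rows 4 1) (RZ := R.rows 4 2)
      (rowX := fun j => (rt j).1) (rowY := fun j => (rt j).2.1) (rowZ := fun j => (rt j).2.2) mt0 mt1 mt2 mP ρ
      (ps.map HeadPartOdd.vt) 0 htt hgt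
  rw [List.drop_zero] at e30 e31 e32 e40 e41 e42 e50 e51 e52 e00 et0 et1 et2
  have M3 : PMem3 R.S (a30, a31, a32) (sumV HeadPartOdd.v3 ps) := ⟨pm30, pm31, pm32⟩
  have M4 : PMem3 R.S (a40, a41, a42) (sumV HeadPartOdd.v4 ps) := ⟨pm40, pm41, pm42⟩
  have M5 : PMem3 R.S (a50, a51, a52) (sumV HeadPartOdd.v5 ps) := ⟨pm50, pm51, pm52⟩
  have Mt : PMem3 R.S (at0, at1, at2) (sumV HeadPartOdd.vt ps) := ⟨pmt0, pmt1, pmt2⟩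
  -- the five family values
  have V3 : headSumR (fun q => regAB (-t / 2) (t / 2) ((C.ctr : ℝ) + ρ) C.ℓ q.1 q.2) (fun ab => (c 2 ab : ℝ))
      L.toFinset C.ℓ C.F ((p.1 + p.2) / 2) ((C.ctr : ℝ) + ρ) (-1) = val3 (a30, a31, a32) ρ ((p.1 + p.2) / 2 - R.b0) :=
    headSumR_val3 C.ℓ C.ctr C.F ρ _ r3 (fun q hq E => (s3 q hq).2 E) vS e30 e31 e32
  have V4 : headSumR (fun q => regAB (t / 2) (t / 2) ((C.ctr : ℝ) + ρ) C.ℓ q.1 q.2) (fun ab => (c 3 ab : ℝ))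
      L.toFinset C.ℓ C.F p.1 ((C.ctr : ℝ) + ρ) (-1) = val3 (a40, a41, a42) ρ (p.1 - R.σ0) :=
    headSumR_val3 C.ℓ C.ctr C.F ρ _ r4 (fun q hq E => (s4 q hq).2 E) vP e40 e41 e42
  have V5 : headSumR (fun q => regAB (t / 2) (t / 2) ((C.ctr : ℝ) + ρ) C.ℓ q.1 q.2) (fun ab => (c 4 ab : ℝ))
      L.toFinset C.ℓ C.F p.1 ((C.ctr : ℝ) + ρ) 1 = val3 (a50, a51, a52) ρ (p.1 - R.σ0) :=
    headSumR_val3 C.ℓ C.ctr C.F ρ _ r5 (fun q hq E => (s5 q hq).2 E) vP e50 e51 e52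
  have V0 : headSumR (fun q => regAB (-t / 2) (-t / 2) ((C.ctr : ℝ) + ρ) C.ℓ q.1 q.2) (fun ab => (ψ ab : ℝ))
      Lψ.toFinset C.ℓ C.F 0 ((C.ctr : ℝ) + ρ) 0 = evalR a00 ρ := by
    have key := headSumR_eq_evalR (coef := fun q => regAB (-t / 2) (-t / 2) ((C.ctr : ℝ) + ρ) C.ℓ q.1 q.2)
      (w := fun ab => (ψ ab : ℝ)) (Sx := Lψ.toFinset) (s := (0 : ℝ)) (σ := (0 : ℝ)) C.ℓ C.ctr C.F ρ
      (row := fun j => (r0 j).1) (by intro q hq E; rw [(s0 q hq).2 E, val3]; ring) vM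
    rw [key, e00]
  have Vt : headSumR (fun q => regAB (t / 2) (t / 2) ((C.ctr : ℝ) + ρ) C.ℓ q.1 q.2) (fun ab => (ψ ab : ℝ))
      Lψ.toFinset C.ℓ C.F (p.1 - p.2) ((C.ctr : ℝ) + ρ) 0 = val3 (at0, at1, at2) ρ ((p.1 - p.2) - R.t0) :=
    headSumR_val3 C.ℓ C.ctr C.F ρ _ rt (fun q hq E => (st q hq).2 E) vP et0 et1 et2
  -- scalars
  have hc3 : MI.mem R.S ((1 / 2 : ℝ) ^ (p.2 - p.1) * (((-1 : ℚ) ^ C.ℓ : ℚ) : ℝ)) (smulRatMI K ((-1) ^ C.ℓ)) :=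
    mem_smulRatMI (hK p hp) _
  have hc0 : MI.mem R.S ((1 / 2 : ℝ) ^ (-(2 * p.1)) * ((κ₀⁻¹ / 2 : ℚ) : ℝ)) (smulRatMI Mσ (κ₀⁻¹ / 2)) :=
    mem_smulRatMI (hMσ p hp) _
  have hct : MI.mem R.S ((1 / 2 : ℝ) ^ (-(2 * p.2)) * ((-(κ₀⁻¹ / 2) : ℚ) : ℝ)) (smulRatMI Mε (-(κ₀⁻¹ / 2))) :=
    mem_smulRatMI (hMε p hp) _
  -- the sign test
  have hmain := hsound M3 M4 M5 pm00 Mt hc3 hc0 hct hδb hδσ hδt hρ1 hρ2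
  -- the regularised bracket sum
  have hsum := sum_oddBracketReg L.toFinset (fun k ab => (c k ab : ℝ)) Lψ.toFinset (fun ab => (ψ ab : ℝ))
    (κ₀ : ℝ) p.1 p.2 ((C.ctr : ℝ) + ρ) C.ℓ C.F
  have e2a : -(p.1 - p.2) / 2 = -t / 2 := by rw [htdef]
  have e2b : (p.1 - p.2) / 2 = t / 2 := by rw [htdef]
  simp only [e2a, e2b] at hsum
  rw [V3, V4, V5, V0, Vt] at hsum
  have hreg : 0 < (C.F.map fun q => (1 / 2 : ℝ) ^ q.1 *
      oddBracketReg L.toFinset (fun k ab => (c k ab : ℝ)) Lψ.toFinset (fun ab => (ψ ab : ℝ)) (κ₀ : ℝ) p.1 p.2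
        ((C.ctr : ℝ) + ρ) C.ℓ q).sum := by
    rw [hsum]
    convert hmain using 1
    push_cast
    ring
  -- remove the regularisation factor
  have hfac : (C.F.map fun q => (1 / 2 : ℝ) ^ q.1 *
      oddBracketReg L.toFinset (fun k ab => (c k ab : ℝ)) Lψ.toFinset (fun ab => (ψ ab : ℝ)) (κ₀ : ℝ) p.1 p.2
        ((C.ctr : ℝ) + ρ) C.ℓ q).sum =
      (Δ - unitarityBound3D C.ℓ) * (C.F.map fun q => (1 / 2 : ℝ) ^ q.1 *
        oddConeHeadBracket L.toFinset (fun k ab => (c k ab : ℝ)) Lψ.toFinset (fun ab => (ψ ab : ℝ)) (κ₀ : ℝ) p.1 p.2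
          Δ C.ℓ q).sum := by
    rw [← List.sum_map_mul_left]
    congr 1
    refine List.map_congr_left fun q _ => ?_
    rw [← hΔ, oddBracketReg_eq _ _ _ _ _ _ _ hbΔ]; ring
  rw [hfac] at hreg
  have hx : 0 < Δ - unitarityBound3D C.ℓ := sub_pos.mpr hbΔ
  have h' := (pos_iff_pos_of_mul_pos hreg).mp hx
  -- back to the Finset statement
  have hFj' : ∀ q ∈ C.F.toFinset, (q.2 : ℝ) ≤ Δ + (q.1 : ℝ) := by
    intro q hq
    have h1 : q.2 ≤ C.ℓ + q.1 := hFj q (List.mem_toFinset.mp hq)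
    have : (q.2 : ℝ) ≤ (C.ℓ : ℝ) + (q.1 : ℝ) := by exact_mod_cast h1
    linarith
  rw [sum_oddConeHeadValue_half_nonneg_iff _ _ _ _ _ _ _ _ _ _ hFj', List.sum_toFinset _ hF]
  have h'' := h'.le
  simpa [Real.rpow_natCast] using h''


/-- **TABLE THEOREM, odd head cell over a wide box, MERGED final test.** [cite: KosPolandSimmonsduffin2014, §3.3 eq. (3.16)] -/
theorem oddHead_nonneg_of_partsΔM (c : Fin 5 → ℕ × ℕ → ℚ) {L : List (ℕ × ℕ)} (ψ : ℕ × ℕ → ℚ) {Lψ : List (ℕ × ℕ)}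
    {κ₀ : ℚ} {C : EvenCellTM} (hF : C.F.Nodup) (hFj : ∀ q ∈ C.F, q.2 ≤ C.ℓ + q.1) (hℓlo : (C.ℓ : ℚ) ≤ C.lo)
    {σlo σhi εlo εhi : ℚ} {R : OddHeadRowsΔ} (hR : R.ValidΔ c L ψ Lψ σlo σhi εlo εhi) {t₁ t₂ : ℚ}
    (ht₁ : t₁ ≤ σlo - εhi) (ht₂ : σhi - εlo ≤ t₂) {K Mσ Mε : MI}
    (hK : ∀ p ∈ Icc (σlo : ℝ) σhi ×ˢ Icc (εlo : ℝ) εhi, MI.mem R.S ((1 / 2 : ℝ) ^ (p.2 - p.1)) K)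
    (hMσ : ∀ p ∈ Icc (σlo : ℝ) σhi ×ˢ Icc (εlo : ℝ) εhi, MI.mem R.S ((1 / 2 : ℝ) ^ (-(2 * p.1))) Mσ)
    (hMε : ∀ p ∈ Icc (σlo : ℝ) σhi ×ˢ Icc (εlo : ℝ) εhi, MI.mem R.S ((1 / 2 : ℝ) ^ (-(2 * p.2))) Mε)
    {dP : ℕ} {ps : List HeadPartOdd} (hparts : ∀ p ∈ ps, oddHeadPartOKΔ R C t₁ t₂ p = true)
    (h : oddHeadFinalOKΔM R dP C t₁ t₂ K Mσ Mε κ₀ ps = true) :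
    ∀ p ∈ Icc (σlo : ℝ) σhi ×ˢ Icc (εlo : ℝ) εhi, ∀ Δ : ℝ, (C.lo : ℝ) ≤ Δ → Δ ≤ C.hi → unitarityBound3D C.ℓ < Δ →
      0 ≤ ∑ q ∈ C.F.toFinset, oddConeHeadValue
        (taylorCrossing (1 / 2) (1 / 2) L.toFinset (fun k ab => (c k ab : ℝ)))
        (∑ ab ∈ Lψ.toFinset, (ψ ab : ℝ) • taylorCoeffAt (1 / 2) (1 / 2) ab) κ₀ p.1 p.2 Δ C.ℓ q := by
  have hS : 0 < R.S := hR.1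
  simp only [oddHeadFinalOKΔM, Bool.and_eq_true] at h
  obtain ⟨hst, hpos⟩ := h
  refine oddHead_nonneg_of_partsΔ_sound c ψ hF hFj hℓlo hR ht₁ ht₂ hK hMσ hMε hparts hst ?_
  intro r3 r4 r5 rt r0 m3 m4 m5 m0 mt c3 c0 ct hc3 hc0 hct δb δσ δt hδb hδσ hδt x hlo hhi
  exact posOnOddM_sound hS m3 m4 m5 m0 mt hc3 hc0 hct hδb hδσ hδt hpos hlo hhi

namespace TaylorTable

variable (T : TaylorTable)

/-- **Final check of odd cell `i`, merged form** — one declaration each. [folklore] -/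
def oddFinalOKM (H : OddHeadCertΔ) (i : ℕ) : Bool :=
  oddHeadFinalOKΔM H.R (H.celldP i) (H.cellTM i) H.t₁ H.t₂ (T.KI H.R.S) (T.MσI H.R.S) (T.MεI H.R.S) T.κ₀ (H.cellParts i)

/-- **`OddHeads` from a δ-expanded FAST odd head certificate, merged final checks.** [cite: KosPolandSimmonsduffin2014, §3.3 eq. (3.16)] -/
theorem oddHeads_of_certΔM (H : OddHeadCertΔ) (hI : T.checkIdentity = true) (hS : T.oddCells.all T.checkOddCellS = true)
    (hm : T.oddMatchOKΔ H = true) (hV : H.R.ValidΔ T.c T.L T.ψ T.Lψ T.σlo T.σhi T.εlo T.εhi)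
    (hparts : ∀ i k : ℕ, i < T.oddCells.length → k < H.numParts i → H.partOK i k = true)
    (hfinal : ∀ i : ℕ, i < T.oddCells.length → T.oddFinalOKM H i = true) : T.OddHeads := by
  intro C hC p hp Δ hlo hhi hbΔ
  obtain ⟨i, hi, hCi⟩ := List.getElem_of_mem hC
  simp only [oddMatchOKΔ, Bool.and_eq_true, decide_eq_true_eq, List.all_eq_true, List.mem_range] at hm
  obtain ⟨⟨⟨_, ht₁⟩, ht₂⟩, hall⟩ := hm
  have hmi := hall i hi
  rw [List.getElem?_eq_getElem hi, hCi] at hmi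
  obtain ⟨hℓ, hF, hlo', hhi', hℓlo⟩ := oddCellMatch_spec hmi
  rw [List.all_eq_true] at hS
  have hcell := hS C hC
  simp only [checkOddCellS, Bool.and_eq_true, decide_eq_true_eq, List.all_eq_true] at hcell
  obtain ⟨⟨⟨hFnd, hFj⟩, _⟩, _⟩ := hcell
  have hFnd' : (H.cellTM i).F.Nodup := by rw [hF]; exact hFnd
  have hFj' : ∀ q ∈ (H.cellTM i).F, q.2 ≤ (H.cellTM i).ℓ + q.1 := by rw [hF, hℓ]; exact fun q hq => hFj q hq
  have hparts' : ∀ p' ∈ H.cellParts i, oddHeadPartOKΔ H.R (H.cellTM i) H.t₁ H.t₂ p' = true := by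
    intro p' hp'
    obtain ⟨k, hk, hpk⟩ := List.getElem_of_mem hp'
    simpa only [OddHeadCertΔ.partOK, OddHeadCertΔ.part, List.getD_eq_getElem _ _ hk, hpk] using hparts i k hi hk
  have hsc := T.scalars_mem_of_checkIdentity hI H.R.S
  have hlo'' : ((H.cellTM i).lo : ℝ) ≤ Δ := le_trans (by exact_mod_cast hlo') hlo
  have hhi'' : Δ ≤ ((H.cellTM i).hi : ℝ) := le_trans hhi (by exact_mod_cast hhi')
  have hbΔ' : unitarityBound3D (H.cellTM i).ℓ < Δ := by rw [hℓ]; exact hbΔ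
  have h := oddHead_nonneg_of_partsΔM T.c T.ψ hFnd' hFj' hℓlo hV ht₁ ht₂ (fun q hq => (hsc q hq).1)
    (fun q hq => (hsc q hq).2.1) (fun q hq => (hsc q hq).2.2) hparts' (hfinal i hi) p hp Δ hlo'' hhi'' hbΔ'
  rw [hF, hℓ] at h; exact h

/-- **ALL-FAST capstone, merged odd final checks.** Structural checks, an even head certificate, an odd head certificate (merged
final checks), and the two region layers ⇒ the box is excluded. [cite: KosPolandSimmonsduffin2014, §3.3 eq. (3.16)] -/
theorem boxExcluded_of_taylorTable_certΔM (h : T.checkS = true)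
    (HE : EvenHeadCertΔ) (hmE : T.evenMatchOKΔ HE = true) (hVE : HE.R.ValidΔ T.c T.L T.σlo T.σhi T.εlo T.εhi)
    (hpE : ∀ i k : ℕ, i < T.evenCells.length → k < HE.numParts i → HE.partOK i k = true)
    (hfE : ∀ i : ℕ, i < T.evenCells.length → HE.finalOK i = true)
    (HO : OddHeadCertΔ) (hmO : T.oddMatchOKΔ HO = true) (hVO : HO.R.ValidΔ T.c T.L T.ψ T.Lψ T.σlo T.σhi T.εlo T.εhi)
    (hpO : ∀ i k : ℕ, i < T.oddCells.length → k < HO.numParts i → HO.partOK i k = true)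
    (hfO : ∀ i : ℕ, i < T.oddCells.length → T.oddFinalOKM HO i = true)
    (hR : TaylorEvenRegion T.α T.box ((T.E₀ : ℚ) : ℝ)) (hC : T.OddCone) : BoxExcluded T.box := by
  have h' := h; simp only [checkS, Bool.and_eq_true] at h'
  obtain ⟨⟨⟨⟨⟨_, hI⟩, hEcells⟩, _⟩, hOcells⟩, _⟩ := h'
  exact T.boxExcluded_of_taylorTable_heads h (T.evenHeads_of_certΔ HE hEcells hmE hVE hpE hfE)
    (T.oddHeads_of_certΔM HO hI hOcells hmO hVO hpO hfO) hR hC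

end TaylorTable

end Summit.CriticalPhenomena.Ising3D
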